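import Summits.HubbardSuperconductivity.HubbardSuperconductivity.Theorems.AnisotropyChordTowerBridge
import Summits.HubbardSuperconductivity.HubbardSuperconductivity.Theorems.AnisotropyChordTotalSpinTransfer

/-!
# Route `AnisotropyChord` / H0 rotor rung, route (1) «ODLRO transfer across sectors»: the TRANSFER INEQUALITY
# `⟨S⃗²⟩_a ≥ ⟨S⃗²⟩_b − (1 − Z)‖S⁺b‖²` (port + proof of theory seat `hubbard-h0-rotor-theory-1`'s `SpinSquaredTransfer`,
# cycle 12 `PartE.lean`, memo ROTOR-THEORY-11 §175(i), THEOREMS M26; landing plan item 1 of THEOREM-T.md)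

For a unit real amplitude `b` in the sector `Sᶻ = M` with `S⁺b ≠ 0` and any unit real amplitude `a` (read in sector `M+1`):
`totalSpinSq b M − (1 − towerFidelity b a)·raiseNormSq b ≤ totalSpinSq a (M+1)` — one Cauchy–Schwarz
(`⟨a, S⁺b⟩² ≤ ‖S⁻a‖²‖b‖²`, tree `towerSum_sq_le`) plus the tree identity `‖S⁻a‖² − ‖S⁺b‖² = ⟨S⃗²⟩_a(M+1) − ⟨S⃗²⟩_b(M)`
(`lowerNormSq_sub_raiseNormSq_eq`).  This is the per-link bookkeeping step of the theory seat's conditional THEOREM T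
(KLS + symmetric z = 1 gap ⇒ BEC at `N = |V|/2 ± k`); the other inputs (`LadderExcessBound`, `PerronTranslationInvariant`,
`SectorZeroGlobalGround`, hypothesis `SymmetricSectorGap`) are separate items.  Nothing here is a statement about the Hubbard model.
-/

set_option linter.dupNamespace false
set_option autoImplicit false

noncomputable section

open Finset Filter Topology
open Literature.MathematicalPhysics.QuantumLattice Literature.Probability.LatticeModels
open Summit.HubbardSuperconductivity.HubbardSuperconductivity.Theorems.AnisotropyChord.InsertionEntropy
open Summit.HubbardSuperconductivity.HubbardSuperconductivity.Theorems.AnisotropyChord.Tower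

namespace Summit.HubbardSuperconductivity.HubbardSuperconductivity.Theorems.AnisotropyChord.Transfer

variable (L : ℕ) [NeZero L]

/-- real amplitude as a complex vector (VERBATIM port of the theory seat's `cplx`, PartE.lean). [folklore] -/
def cplx (φ : TensorIndex (TorusSite 2 L) 2 → ℝ) : TensorIndex (TorusSite 2 L) 2 → ℂ := fun σ => (φ σ : ℂ)

/-- **TRANSFER INEQUALITY** (VERBATIM port of the theory seat's `SpinSquaredTransfer`, PartE.lean, cycle 12): for unit real
amplitudes `b` (sector `M`, `S⁺b ≠ 0`) and `a` (any unit), with `Z = towerFidelity b a = ⟨a,S⁺b⟩²/‖S⁺b‖²`: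
`⟨S⃗²⟩_a ≥ ⟨S⃗²⟩_b − (1 − Z)·‖S⁺b‖²` («removal from a beats Z × addition to b»).  Loss per link `(1−Z)‖S⁺b‖² ≤ (1−Z)|V|²/4`.
[conjecture: theory seat hubbard-h0-rotor-theory-1, cycle 12, memo §175(i) — PROVED on paper (one line); Lean proof below] -/
def SpinSquaredTransfer : Prop :=
  ∀ (L : ℕ) [NeZero L] (M : ℝ) (b a : TensorIndex (TorusSite 2 L) 2 → ℝ),
    cplx L b ∈ spinZSector (Λ := TorusSite 2 L) 1 M →
    ∑ σ, b σ ^ 2 = 1 → ∑ σ, a σ ^ 2 = 1 → 0 < raiseNormSq b →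
      Summit.HubbardSuperconductivity.HubbardSuperconductivity.Theorems.AnisotropyChord.Tower.totalSpinSq b M
        - (1 - towerFidelity b a) * raiseNormSq b
        ≤ Summit.HubbardSuperconductivity.HubbardSuperconductivity.Theorems.AnisotropyChord.Tower.totalSpinSq a (M + 1)

variable {L}

/-- **Support of a sector amplitude:** a real amplitude in the sector `Sᶻ_tot = M` is supported on the configurations with
`|V|/2 + M` up spins (`Σ_x (1/2 − σ_x) = M` read in `ℝ`). [folklore] -/
theorem zerosCard_of_mem_spinZSector {M : ℝ} {b : TensorIndex (TorusSite 2 L) 2 → ℝ}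
    (hb : cplx L b ∈ spinZSector (Λ := TorusSite 2 L) 1 M) (σ : TensorIndex (TorusSite 2 L) 2) (hσ : b σ ≠ 0) :
    ((univ.filter fun x => σ x = 0).card : ℝ) = (Fintype.card (TorusSite 2 L) : ℝ) / 2 + M := by
  have h := (LiebMattis.mem_spinZSector_iff (Λ := TorusSite 2 L) 1 M (cplx L b)).1 hb σ
    (by unfold cplx; exact_mod_cast hσ)
  have hre : (∑ x : TorusSite 2 L, ((1 : ℝ) / 2 - (σ x : ℕ))) = M := by
    have h' : (((∑ x : TorusSite 2 L, ((1 : ℝ) / 2 - (σ x : ℕ)) : ℝ)) : ℂ) = (M : ℂ) := by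
      push_cast at h ⊢; exact h
    exact_mod_cast h'
  have hsplit : (∑ x : TorusSite 2 L, ((1 : ℝ) / 2 - (σ x : ℕ)))
      = (Fintype.card (TorusSite 2 L) : ℝ) / 2 - ∑ x : TorusSite 2 L, ((σ x : ℕ) : ℝ) := by
    rw [Finset.sum_sub_distrib, Finset.sum_const, Finset.card_univ, nsmul_eq_mul]; ring
  have hones : (∑ x : TorusSite 2 L, ((σ x : ℕ) : ℝ))
      = (Fintype.card (TorusSite 2 L) : ℝ) - ((univ.filter fun x => σ x = 0).card : ℝ) := by
    have h1 : ∀ x : TorusSite 2 L, ((σ x : ℕ) : ℝ) = 1 - (if σ x = 0 then (1:ℝ) else 0) := by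
      intro x
      rcases Fin.exists_fin_two.mp ⟨σ x, rfl⟩ with hx | hx <;> simp [hx]
    simp_rw [h1]
    rw [Finset.sum_sub_distrib, Finset.sum_const, Finset.card_univ, nsmul_eq_mul, mul_one]
    rw [← Finset.sum_filter]; simp
  rw [hsplit, hones] at hre
  linarith

/-- **THE TRANSFER INEQUALITY HOLDS.** Proof: `Z·‖S⁺b‖² = ⟨a, S⁺b⟩² ≤ ‖S⁻a‖²·‖b‖² = ‖S⁻a‖²` (Cauchy–Schwarz,
`towerSum_sq_le`, `towerSum_sq_eq`) and `‖S⁻a‖² − ‖S⁺b‖² = ⟨S⃗²⟩_a(M+1) − ⟨S⃗²⟩_b(M)` (`lowerNormSq_sub_raiseNormSq_eq`, with the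
support of `b` read off its sector). [conjecture: theory seat hubbard-h0-rotor-theory-1, cycle 12 — TRANSFER; Lean proof here] -/
theorem spinSquaredTransfer_holds : SpinSquaredTransfer := by
  intro L _ M b a hb hunitb _hunita _hpos
  set n : ℝ := (Fintype.card (TorusSite 2 L) : ℝ) / 2 + M with hn
  have hsupp : ∀ ν, b ν ≠ 0 → ((univ.filter fun x => ν x = 0).card : ℝ) = n :=
    fun ν hν => zerosCard_of_mem_spinZSector hb ν hν
  have hid := lowerNormSq_sub_raiseNormSq_eq b a n hunitb hsupp
  have e1 : n - (Fintype.card (TorusSite 2 L) : ℝ) / 2 + 1 = M + 1 := by rw [hn]; ring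
  have e2 : n - (Fintype.card (TorusSite 2 L) : ℝ) / 2 = M := by rw [hn]; ring
  rw [e1, e2] at hid
  have hcs : towerSum b a ^ 2 ≤ lowerNormSq a := by
    have := towerSum_sq_le b a
    rwa [hunitb, one_mul] at this
  have hF : towerSum b a ^ 2 = towerFidelity b a * raiseNormSq b := towerSum_sq_eq b a
  nlinarith [hcs, hF, hid]

end Summit.HubbardSuperconductivity.HubbardSuperconductivity.Theorems.AnisotropyChord.Transfer
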